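import Summits.QuantumFields.YangMills.Theorems.FradkinShenkerFlowStrongPinningPoincareOfOneLinkLaplace
import Literature.MathematicalPhysics.QuantumFieldTheory.PinnedOneLinkLaplace

/-!
# `StrongPinningPoincare` modulo the named fact `OneLinkLaplaceConcentration`

Route `FradkinShenkerFlow` of `YangMills`, support item `stmt-QuantumFields-9446`: the conditional
form of `StrongPinningPoincare` with its single unproved input named —
`Literature.MathematicalPhysics.QuantumFieldTheory.OneLinkLaplaceConcentration` (the Laplace
concentration of strongly pinned one-link laws). Everything else is proved in
`FradkinShenkerFlowStrongPinningPoincareOfOneLinkLaplace` and its imports.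
-/

noncomputable section

open Literature.MathematicalPhysics.QuantumFieldTheory

namespace Summit.QuantumFields.YangMills.Theorems.StrongPinningPoincare

/-- **`StrongPinningPoincare`, conditional on `OneLinkLaplaceConcentration`**: the route item
follows from the named one-link Laplace concentration fact by
`strongPinningPoincare_of_oneLinkLaplace` (abstract Kantorovich–Rubinstein-Dobrushin ⇒ heat-bath
Poincaré `HeatBath.variance_le_of_kr`, the tree's perturbation lemma
`abs_integral_tilted_add_sub_le`, and the lattice mixed Lipschitz bound
`Lattice.abs_dd_wilsonAction_le`). [folklore] -/
theorem strongPinningPoincare_of_oneLinkLaplaceConcentration (h : OneLinkLaplaceConcentration) :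
    Summit.QuantumFields.YangMills.Theses.FradkinShenkerFlow.StrongPinningPoincare :=
  strongPinningPoincare_of_oneLinkLaplace h

end Summit.QuantumFields.YangMills.Theorems.StrongPinningPoincare

end
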